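import Literature.AlgebraicGeometry.Resolution.KummerChart
import Literature.AlgebraicGeometry.Resolution.KummerToricAlgebraLocal
import Literature.AlgebraicGeometry.Resolution.LogRegularScheme
import HarnessLib

/-!
# The Kummer chart is log regular at the closed point (Kato 1994, Def. (2.1), (2.2)(2))

Topic: `Literature/AlgebraicGeometry/Resolution`. For a regular local ring `O`, boundary
equations `x_1, …, x_r ∈ 𝔪` independent modulo `𝔪²`, and `c : Fin r → ℕ` with `c_{j₀} = 1`, the
Kummer chart `P → T` (`KummerChart.lean`) of the Kummer cone into the toric algebra of the
normalised Kummer cover `τ^p = x^c` is LOGARITHMICALLY REGULAR at the closed point in the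
sense of K. Kato, *Toric singularities*, Amer. J. Math. 116 (1994), Def. (2.1)
(`LogChart.IsLogRegularLocal`, `LogRegularScheme.lean`): its face of units is `{0}`
(`unitFace_toricChart`), Kato's ideal `I` is the monomial ideal of `T`
(`nonunitIdeal_toricChart`, `KummerToricAlgebraLocal.lean`), `T/I ≅ O/(x)` is regular and
`dim T = dim T/I + r` (`isLogRegularLocal_toricChart`). This is Kato's example (2.2)(2) (an snc
pair is log regular) combined with the normalisation of the `p`-cyclic Kummer cover along the
boundary — the local model at a Kummer point of the endgame of the crux `PicoverLocalModel`.

* `RootCover.liftExp`, `kummerExp_liftExp`, `chart_liftExp` — every Kummer monomial is a chart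
  value; `isUnit_toricChart_iff`, `unitFace_toricChart`; `toricChart_mem_toricIdeal`,
  `nonunitIdeal_toricChart`; `isLogRegularLocal_toricChart`.

Sources: [Kato1994] K. Kato, Amer. J. Math. 116 (1994), Def. (2.1), (2.2)(2), Thm. (4.1).
-/

noncomputable section

namespace Literature.AlgebraicGeometry.Resolution

open MvPolynomial IsLocalRing

namespace RootCover

variable {O : Type*} [CommRing O] {r : ℕ} {p : ℕ} [hp : Fact p.Prime] {x : Fin r → O}
variable {j₀ : Fin r} {c : Fin r → ℕ}

/-! ## Lifting Kummer exponents to the cone -/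

/-- The cone element `v` with `kummerExp v = n` for a Kummer exponent `n` (`c_{j₀} = 1`):
`v_{j₀} = n_{j₀}`, `v_j = (n_j - c_j n_{j₀})/p`. [folklore] -/
def liftExp (p : ℕ) (j₀ : Fin r) (c : Fin r → ℕ) (n : Fin r → Fin p) : Fin r → ℤ :=
  fun j => if j = j₀ then (n j₀ : ℕ) else (((n j : ℕ) : ℤ) - c j * (n j₀ : ℕ)) / p

omit hp in
/-- `kummerExp (liftExp n) = n` for a Kummer exponent `n`. [folklore] -/
theorem kummerExp_liftExp (hc : c j₀ = 1) {n : Fin r → Fin p} (hn : IsKummerExp p j₀ c n) :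
    kummerExp p j₀ c (liftExp p j₀ c n) = fun j => ((n j : ℕ) : ℤ) := by
  ext j
  by_cases hj : j = j₀
  · subst hj
    rw [kummerExp_apply_self]
    simp [liftExp]
  · rw [kummerExp_apply_of_ne p c _ hj]
    simp only [liftExp, if_neg hj, if_true]
    have hdvd : (p : ℤ) ∣ ((n j : ℕ) : ℤ) - c j * (n j₀ : ℕ) := by
      have h := hn j
      rw [← Int.cast_natCast (n j : ℕ), ← Int.cast_natCast (c j), ← Int.cast_natCast (n j₀ : ℕ),
        ← Int.cast_mul, eq_comm, ZMod.intCast_eq_intCast_iff_dvd_sub] at h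
      exact h
    rw [Int.mul_ediv_cancel' hdvd]
    ring

omit hp in
/-- The lift of a Kummer exponent lies in the cone. [folklore] -/
theorem liftExp_mem_kummerCone (hc : c j₀ = 1) {n : Fin r → Fin p} (hn : IsKummerExp p j₀ c n) :
    liftExp p j₀ c n ∈ kummerCone p j₀ c := by
  intro j
  rw [kummerExp_liftExp hc hn]
  positivity

omit hp in
/-- `natExp` of the lift is `n`. [folklore] -/
theorem natExp_liftExp (hc : c j₀ = 1) {n : Fin r → Fin p} (hn : IsKummerExp p j₀ c n) :
    natExp p j₀ c ⟨liftExp p j₀ c n, liftExp_mem_kummerCone hc hn⟩ = fun j => (n j : ℕ) := by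
  ext j
  apply Int.ofNat.inj
  change ((natExp p j₀ c _ j : ℕ) : ℤ) = ((n j : ℕ) : ℤ)
  rw [natExp_cast]
  exact congrFun (kummerExp_liftExp hc hn) j

/-- A box exponent read as an `ℕ`-vector gives back the box monomial. [folklore] -/
theorem rootMonomial_val (n : Fin r → Fin p) :
    rootMonomial p x (fun j => (n j : ℕ)) = boxMonomial p x n := by
  rw [rootMonomial_eq_smul_boxMonomial]
  have h1 : ∏ j, x j ^ ((n j : ℕ) / p) = 1 :=
    Finset.prod_eq_one fun j _ => by rw [Nat.div_eq_of_lt (n j).2, pow_zero]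
  have h2 : modBox' (p := p) (fun j => (n j : ℕ)) = n := by
    ext j; simp [modBox', Nat.mod_eq_of_lt (n j).2]
  rw [h1, h2, one_smul]

/-- Every Kummer monomial is a value of the chart. [cite: Kato1994, (2.2)(2)] -/
theorem chart_liftExp (hc : c j₀ = 1) {n : Fin r → Fin p} (hn : IsKummerExp p j₀ c n) :
    chart p x j₀ c (Multiplicative.ofAdd ⟨liftExp p j₀ c n, liftExp_mem_kummerCone hc hn⟩) =
      boxMonomial p x n := by
  rw [chart_apply, toAdd_ofAdd, natExp_liftExp hc hn, rootMonomial_val]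

/-! ## Units of the chart -/

omit hp in
/-- A root monomial with a non-zero exponent lies in the ideal of the roots. [folklore] -/
theorem rootMonomial_mem_span_root {e : Fin r → ℕ} (he : e ≠ 0) :
    rootMonomial p x e ∈ Ideal.span (Set.range (root p x)) := by
  obtain ⟨j, hj⟩ : ∃ j, e j ≠ 0 := by
    by_contra hall; push Not at hall; exact he (funext hall)
  rw [rootMonomial, ← Finset.mul_prod_erase _ _ (Finset.mem_univ j)]
  exact Ideal.mul_mem_right _ _ (Ideal.pow_mem_of_mem _
    (Ideal.subset_span (s := Set.range (root p x)) ⟨j, rfl⟩) _ (Nat.pos_of_ne_zero hj))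

/-- **In a local base with `x_j ∈ 𝔪`, the chart value at `v` is a unit of the toric algebra
only for `v = 0`.** [cite: Kato1994, Def. (2.1)] -/
theorem isUnit_toricChart_iff [IsLocalRing O] (hx : ∀ j, x j ∈ maximalIdeal O) (hc : c j₀ = 1)
    (v : Multiplicative (kummerCone p j₀ c)) : IsUnit (toricChart p x j₀ c hc v) ↔ v = 1 := by
  constructor
  · intro hu
    obtain ⟨hloc, hmax⟩ := isLocalRing (p := p) hx
    have hu' : IsUnit (chart p x j₀ c v) := hu.map (toric p x j₀ c).val
    by_contra hv
    have hne : natExp p j₀ c v.toAdd ≠ 0 := fun h =>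
      hv (Multiplicative.toAdd.injective (by rw [toAdd_one]; exact (natExp_eq_zero_iff _).mp h))
    apply (IsLocalRing.mem_maximalIdeal _).mp ?_ hu'
    rw [hmax, chart_apply]
    exact Ideal.mem_sup_right (rootMonomial_mem_span_root hne)
  · rintro rfl
    rw [map_one]
    exact isUnit_one

/-- The face of units of the Kummer chart at the closed point is `{0}`. [cite: Kato1994, Def. (2.1)] -/
theorem unitFace_toricChart [IsLocalRing O] (hx : ∀ j, x j ∈ maximalIdeal O) (hc : c j₀ = 1) :
    LogChart.unitFace (kummerCone p j₀ c) (toricChart p x j₀ c hc) = {0} := by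
  ext v
  rw [LogChart.mem_unitFace_iff, isUnit_toricChart_iff hx hc, Set.mem_singleton_iff]
  exact Multiplicative.ofAdd.injective.eq_iff' rfl

/-! ## Kato's ideal of the chart is the monomial ideal -/

/-- As an element of the toric algebra, the chart value at `v` is `x^{e/p} · s^{e mod p}`,
`e = p·m(v)`. [folklore] -/
theorem toricChart_eq_smul_kummerMonomial (hc : c j₀ = 1) (v : Multiplicative (kummerCone p j₀ c)) :
    toricChart p x j₀ c hc v = (∏ j, x j ^ (natExp p j₀ c v.toAdd j / p)) •
      kummerMonomial p x j₀ c ⟨modBox' (natExp p j₀ c v.toAdd), isKummerExp_modBox'_natExp hc _⟩ :=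
  Subtype.ext (by
    rw [coe_toricChart, chart_apply, rootMonomial_eq_smul_boxMonomial, Subalgebra.coe_smul,
      coe_kummerMonomial])

/-- **Chart values at non-zero cone elements lie in the monomial ideal.**
[cite: Kato1994, Def. (2.1)] -/
theorem toricChart_mem_toricIdeal (hc : c j₀ = 1) {v : Multiplicative (kummerCone p j₀ c)}
    (hv : v ≠ 1) : toricChart p x j₀ c hc v ∈ toricIdeal p x j₀ c := by
  have hne : natExp p j₀ c v.toAdd ≠ 0 := fun h =>
    hv (Multiplicative.toAdd.injective (by rw [toAdd_one]; exact (natExp_eq_zero_iff _).mp h))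
  rw [toricChart_eq_smul_kummerMonomial hc v, Algebra.smul_def]
  set e := natExp p j₀ c v.toAdd with he
  by_cases hmod : modBox' (p := p) e = 0
  · -- all exponents divisible by `p`: the scalar lies in `(x)`
    refine Ideal.mul_mem_right _ _ (Ideal.mem_sup_right (Ideal.mem_map_of_mem _ ?_))
    obtain ⟨j, hj⟩ : ∃ j, e j ≠ 0 := by
      by_contra hall; push Not at hall; exact hne (funext hall)
    have hdiv : e j / p ≠ 0 := by
      intro h0
      have h1 : e j % p = 0 := by
        have := congrFun hmod j
        simp only [modBox', Pi.zero_apply, Fin.ext_iff, Fin.val_zero] at this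
        exact this
      exact hj (by rw [← Nat.div_add_mod (e j) p, h0, h1]; simp)
    rw [← Finset.mul_prod_erase _ _ (Finset.mem_univ j)]
    exact Ideal.mul_mem_right _ _ (Ideal.pow_mem_of_mem _
      (Ideal.subset_span (s := Set.range x) ⟨j, rfl⟩) _ (Nat.pos_of_ne_zero hdiv))
  · refine Ideal.mul_mem_left _ _ (Ideal.mem_sup_left (Ideal.subset_span ⟨⟨modBox' e, ?_, hmod⟩, rfl⟩))
    exact isKummerExp_modBox'_natExp hc _

/-- The lift of a non-zero Kummer exponent is a non-trivial cone element. [folklore] -/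
theorem ofAdd_liftExp_ne_one (hc : c j₀ = 1) {n : Fin r → Fin p} (hn : IsKummerExp p j₀ c n)
    (hn0 : n ≠ 0) :
    (Multiplicative.ofAdd ⟨liftExp p j₀ c n, liftExp_mem_kummerCone hc hn⟩ :
      Multiplicative (kummerCone p j₀ c)) ≠ 1 := by
  intro h
  have h' : liftExp p j₀ c n = 0 := by
    have := congrArg (fun w => ((Multiplicative.toAdd w : kummerCone p j₀ c) : Fin r → ℤ)) h
    simpa using this
  apply hn0
  ext j
  have := congrFun (kummerExp_liftExp hc hn) j
  rw [h', map_zero, Pi.zero_apply] at this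
  have h0 : ((n j : ℕ) : ℤ) = 0 := this.symm
  simpa using h0

/-- **Kato's ideal `I` of the Kummer chart at the closed point is the monomial ideal of the
toric algebra** (generated by the non-empty Kummer monomials and the `x_j`).
[cite: Kato1994, Def. (2.1)] -/
theorem nonunitIdeal_toricChart [IsLocalRing O] (hx : ∀ j, x j ∈ maximalIdeal O) (hc : c j₀ = 1) :
    LogChart.nonunitIdeal (kummerCone p j₀ c) (toricChart p x j₀ c hc) = toricIdeal p x j₀ c := by
  apply le_antisymm
  · refine Ideal.span_le.mpr ?_
    rintro _ ⟨v, hv, rfl⟩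
    refine toricChart_mem_toricIdeal hc fun h1 => hv ?_
    change IsUnit (toricChart p x j₀ c hc (Multiplicative.ofAdd v))
    rw [h1, map_one]; exact isUnit_one
  · have hgen : ∀ v : Multiplicative (kummerCone p j₀ c), v ≠ 1 →
        toricChart p x j₀ c hc v ∈ LogChart.nonunitIdeal (kummerCone p j₀ c) (toricChart p x j₀ c hc) := by
      intro v hv
      refine Ideal.subset_span ⟨Multiplicative.toAdd v, ?_, rfl⟩
      change ¬ IsUnit (toricChart p x j₀ c hc v)
      rw [isUnit_toricChart_iff hx hc]
      exact hv
    refine sup_le (Ideal.span_le.mpr ?_) (Ideal.map_le_iff_le_comap.mpr (Ideal.span_le.mpr ?_))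
    · rintro _ ⟨n, rfl⟩
      have heq : kummerMonomial p x j₀ c ⟨n.1, n.2.1⟩ = toricChart p x j₀ c hc
          (Multiplicative.ofAdd ⟨liftExp p j₀ c n.1, liftExp_mem_kummerCone hc n.2.1⟩) :=
        Subtype.ext (by rw [coe_kummerMonomial, coe_toricChart, chart_liftExp hc n.2.1])
      change kummerMonomial p x j₀ c ⟨n.1, n.2.1⟩ ∈ _
      rw [heq]
      exact hgen _ (ofAdd_liftExp_ne_one hc n.2.1 n.2.2)
    · rintro _ ⟨j, rfl⟩
      rw [SetLike.mem_coe, Ideal.mem_comap]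
      by_cases hj : j = j₀
      · subst hj
        have heq : algebraMap O (toric p x j c) (x j) = toricChart p x j c hc
            (Multiplicative.ofAdd ⟨pivotGen p j c, pivotGen_mem_kummerCone p j c⟩) :=
          Subtype.ext (by rw [coe_toricChart, chart_pivotGen]; rfl)
        rw [heq]
        refine hgen _ fun h => ?_
        have := congrArg (fun w => ((Multiplicative.toAdd w : kummerCone p j c) : Fin r → ℤ) j) h
        simp [pivotGen, hp.out.ne_zero] at this
      · have heq : algebraMap O (toric p x j₀ c) (x j) = toricChart p x j₀ c hc
            (Multiplicative.ofAdd ⟨Pi.single j 1, single_mem_kummerCone p j₀ c j 1⟩) :=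
          Subtype.ext (by rw [coe_toricChart, chart_single j hj]; rfl)
        rw [heq]
        refine hgen _ fun h => ?_
        have := congrArg (fun w => ((Multiplicative.toAdd w : kummerCone p j₀ c) : Fin r → ℤ) j) h
        simp at this

/-! ## Log regularity of the Kummer chart at the closed point (Kato (2.1), (2.2)(2)) -/

/-- **The Kummer chart is log regular at the closed point** (Kato 1994, Def. (2.1), example
(2.2)(2)): for a regular local ring `O`, boundary equations `x_j ∈ 𝔪` independent modulo `𝔪²`,
`c_{j₀} = 1`, the chart `P → T` of the Kummer cone into the toric algebra of the normalised
Kummer cover `τ^p = x^c` satisfies: `T/I` is regular (`≅ O/(x)`) and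
`dim T = dim T/I + (r - rank Fᵍᵖ)` with `F = {0}`. [cite: Kato1994, Def. (2.1) and (2.2)(2)] -/
theorem isLogRegularLocal_toricChart [IsRegularLocalRing O] (hx : ∀ j, x j ∈ maximalIdeal O)
    (hli : ∀ α : Fin r → O, ∑ i, α i * x i ∈ maximalIdeal O ^ 2 → ∀ i, α i ∈ maximalIdeal O)
    (hc : c j₀ = 1) :
    LogChart.IsLogRegularLocal (kummerCone p j₀ c) (toricChart p x j₀ c hc) := by
  obtain ⟨_, _, -, hreg, hdim⟩ := toric_structure (p := p) (x := x) (j₀ := j₀) (c := c) hx hli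
  rw [LogChart.IsLogRegularLocal, nonunitIdeal_toricChart hx hc, unitFace_toricChart hx hc,
    Set.image_singleton, ZeroMemClass.coe_zero, Submodule.span_zero_singleton, finrank_bot,
    Nat.sub_zero]
  exact ⟨hreg, hdim.symm⟩

end RootCover

end Literature.AlgebraicGeometry.Resolution

end
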